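import Summits.AnomalousDissipation.AnomalousDissipation.Theorems.SolenoidalFractalHomogenisationLagrangianStepCellLawVOddGainDefectSlotScalars
import Mathlib.Analysis.Matrix.Spectrum
import HarnessLib

/-!
# K1L `LagrangianRenormalisationStep(Design)` (K1L_D, stmt-AnomalousDissipation-27980), stub `stub_cellLawV0_IS`, IS-half obligation
# `stub_W_evenSlackB` — the SPECTRAL REPRESENTATION of the quasi-static slot response `f_T(B) = qsResp ρ T B` for symmetric blocks and the
# two-sided INVERSION-BULK law in Loewner form (helper; `--supports stmt-AnomalousDissipation-27980 --as helper`; word-independent)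

Summits-side helper file of route `SolenoidalFractalHomogenisation` (prover seat `ad-sawtooth-k1loc-p1` g12, for the even certificate E1 of the
IS-half line of record `Cruxes/LagrangianRenormalisationStep/Lines/onelevel_W_crossing.lean` v2, planner ad-ideate-p5 g11/g12): the landed per-slot
pinch (`…CellLawVQSBlock`, `…CellLawVQSPinch`) sees a symmetric transverse block `B` only through an isotropic window `a ≤ B ≤ b`; the EIGEN-centred
even clause needs ANISOTROPIC reference blocks.  This file supplies, for EVERY real symmetric `B` and every orthonormal eigenbasis `(q_k, β_k)` of it,
* §1 `sum_mul_exp_neg_smul_mulVec_of_left_eig` — a left eigenvector pairs with the semigroup orbit as `e^{-cτ}` (the ODE `y' = -c y`);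
  `sum_mul_exp_neg_smul_mulVec_eq_sum_eig` — **`uᵀ e^{-τB} w = Σ_k e^{-β_k τ} (q_k·u)(q_k·w)`**; `sum_mul_eq_sum_eig` (Parseval, `τ = 0`);
* §2 `sum_sum_mul_qsResp_mul_eq_sum_eig` — **`uᵀ f_T(B) w = Σ_k f_T(β_k) (q_k·u)(q_k·w)`** with the scalar response `f_T = qsRespScalar ρ T`;
* §3 the INVERSION BULK in Loewner form, no matrix inverse (variational `vᵀB⁻¹v = max_w (2v·w − wᵀBw)`, completed squares in the eigenbases):
  `sum_sum_mul_qsResp_mul_le_of_loewner` — **upper**: `B ≥ B₀`, `B ≥ a > 0`, `(q⁰_k, β⁰_k)` an orthonormal eigenbasis of `B₀` with `β⁰_k > 0`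
  ⟹ `vᵀ f_T(B) v ≤ ϑ_∞ Σ_k (q⁰_k·v)²/β⁰_k` (`ϑ_∞ = 1 − 4ρ/3`; the upper law `f_T(x) ≤ ϑ_∞/x` has no lag, so the upper face is EXACTLY
  order-reversing); `sum_sum_mul_qsResp_mul_ge_of_loewner` — **lower**: `B ≤ B₁`, `B ≥ a > 0`, `(q¹_k, β¹_k)` an orthonormal eigenbasis of `B₁`
  ⟹ `ϑ_∞ Σ_k (q¹_k·v)²/β¹_k − (2/(ρ T² a³))·|v|² ≤ vᵀ f_T(B) v` (the Majda–Kramer lag `f_T(x) ≥ (ϑ_∞ − 2/(ρ(Tx)²))/x` of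
  `le_qsRespScalar` is the only order-reversal DEFECT, and it sits on the lower face).
Everything PROVED (Mathlib's spectral theorem supplies one eigenbasis, `Matrix.IsHermitian.eigenvectorBasis`; the statements take ANY), no definition,
no named fact, no sorry.  Infrastructure for rung leaf F-D1.A0; NOT a proof of the stub, of the crux, of Onsager's conjecture or of anomalous dissipation.
-/

set_option linter.dupNamespace false

noncomputable section

namespace Summit.AnomalousDissipation.AnomalousDissipation.Theorems.SolenoidalFractalHomogenisation.LagrangianStep

open Literature.Analysis Literature.Analysis.FluidPDE Literature.Analysis.FunctionSpaces
open Literature.Analysis.ODE.PeriodicAveraging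
open MeasureTheory Set

/-! ## §1 The semigroup `e^{-τB}` of a real symmetric matrix on an orthonormal eigenbasis -/

section Semigroup

variable {m : ℕ}

/-- A real symmetric matrix is Hermitian (entry point to Mathlib's spectral theorem `Matrix.IsHermitian.eigenvectorBasis`). [folklore] -/
theorem isHermitian_of_isSymm {B : Matrix (Fin m) (Fin m) ℝ} (hB : B.IsSymm) : B.IsHermitian := by
  unfold Matrix.IsHermitian
  rw [Matrix.conjTranspose_eq_transpose_of_trivial]
  exact hB

/-- **A left eigenvector pairs with the orbit as a pure exponential**: `Σᵢ uᵢBᵢⱼ = c uⱼ` for all `j` gives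
`u ⬝ e^{-τB} v = e^{-cτ} (u ⬝ v)` (`y = u ⬝ e^{-τB}v` solves `y' = -c y`). [folklore] -/
theorem sum_mul_exp_neg_smul_mulVec_of_left_eig (B : Matrix (Fin m) (Fin m) ℝ) {u : Fin m → ℝ} {c : ℝ}
    (hu : ∀ j, ∑ i, u i * B i j = c * u j) (v : Fin m → ℝ) (τ : ℝ) :
    ∑ i, u i * (NormedSpace.exp (-(τ • B))).mulVec v i = Real.exp (-(c * τ)) * ∑ i, u i * v i := by
  set y : ℝ → ℝ := fun s => ∑ i, u i * (NormedSpace.exp (-(s • B))).mulVec v i with hy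
  have hyd : ∀ s, HasDerivAt y (-(c * y s)) s := by
    intro s
    have h := hasDerivAt_exp_neg_smul_mulVec B v s
    rw [hasDerivAt_pi] at h
    have h2 : HasDerivAt y (∑ i, u i * (-(B.mulVec ((NormedSpace.exp (-(s • B))).mulVec v))) i) s :=
      HasDerivAt.fun_sum fun i _ => (h i).const_mul (u i)
    have heq : ∑ i, u i * (-(B.mulVec ((NormedSpace.exp (-(s • B))).mulVec v))) i = -(c * y s) := by
      simp only [Pi.neg_apply, mul_neg, Finset.sum_neg_distrib]
      rw [sum_mul_mulVec_of_left_eig hu]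
    rw [heq] at h2
    exact h2
  have hF : ∀ s, HasDerivAt (fun s => Real.exp (c * s) * y s) 0 s := by
    intro s
    have h1 : HasDerivAt (fun s => Real.exp (c * s)) (Real.exp (c * s) * c) s := by
      have := ((hasDerivAt_id s).const_mul c).exp
      simpa using this
    refine (h1.fun_mul (hyd s)).congr_deriv ?_
    ring
  have hconst := is_const_of_deriv_eq_zero (𝕜 := ℝ) (f := fun s => Real.exp (c * s) * y s)
    (fun s => (hF s).differentiableAt) (fun s => (hF s).deriv) τ 0
  have hy0 : y 0 = ∑ i, u i * v i := by
    simp only [hy, zero_smul, neg_zero, NormedSpace.exp_zero, Matrix.one_mulVec]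
  have h1 : Real.exp (c * τ) * y τ = ∑ i, u i * v i := by
    have : Real.exp (c * τ) * y τ = Real.exp (c * 0) * y 0 := hconst
    rw [this, hy0, mul_zero, Real.exp_zero, one_mul]
  have hexp : Real.exp (-(c * τ)) * Real.exp (c * τ) = 1 := by
    rw [← Real.exp_add, neg_add_cancel, Real.exp_zero]
  calc y τ = Real.exp (-(c * τ)) * (Real.exp (c * τ) * y τ) := by rw [← mul_assoc, hexp, one_mul]
    _ = _ := by rw [h1]

/-- The real inner product of `EuclideanSpace ℝ (Fin m)` against a plain vector, in coordinates. [folklore] -/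
theorem inner_toLp_eq_sum (x : EuclideanSpace ℝ (Fin m)) (u : Fin m → ℝ) :
    inner ℝ x (WithLp.toLp 2 u) = ∑ i, x i * u i := by
  simp [PiLp.inner_apply, mul_comm]

/-- Coordinates in an orthonormal basis: `uᵢ = Σ_k (q_k·u) (q_k)ᵢ`. [folklore] -/
theorem eq_sum_inner_mul_basis (q : OrthonormalBasis (Fin m) ℝ (EuclideanSpace ℝ (Fin m))) (u : Fin m → ℝ) (i : Fin m) :
    u i = ∑ k, (∑ j, q k j * u j) * q k i := by
  have h := q.sum_repr' (WithLp.toLp 2 u)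
  have hi := congrArg (fun z : EuclideanSpace ℝ (Fin m) => z i) h
  simp only [WithLp.ofLp_sum, WithLp.ofLp_smul, Finset.sum_apply, Pi.smul_apply, smul_eq_mul] at hi
  rw [← hi]
  refine Finset.sum_congr rfl fun k _ => ?_
  rw [inner_toLp_eq_sum]

/-- For a symmetric matrix a (right) eigenvector is a left eigenvector: `Σᵢ (q_k)ᵢ Bᵢⱼ = β_k (q_k)ⱼ`. [folklore] -/
theorem left_eig_of_isSymm {B : Matrix (Fin m) (Fin m) ℝ} (hB : B.IsSymm) {e : Fin m → ℝ} {β : ℝ}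
    (he : B.mulVec e = β • e) (j : Fin m) : ∑ i, e i * B i j = β * e j := by
  have hj := congrArg (fun z => z j) he
  simp only [Matrix.mulVec, dotProduct, Pi.smul_apply, smul_eq_mul] at hj
  rw [← hj]
  refine Finset.sum_congr rfl fun i _ => ?_
  rw [hB.apply i j, mul_comm]

/-- **Spectral representation of the semigroup bilinear form.**  For a real symmetric `B` with an orthonormal eigenbasis `(q_k, β_k)`:
`uᵀ e^{-τB} w = Σ_k e^{-β_k τ} (q_k·u)(q_k·w)`. [folklore] -/
theorem sum_mul_exp_neg_smul_mulVec_eq_sum_eig {B : Matrix (Fin m) (Fin m) ℝ} (hB : B.IsSymm)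
    (q : OrthonormalBasis (Fin m) ℝ (EuclideanSpace ℝ (Fin m))) (β : Fin m → ℝ)
    (hq : ∀ k, B.mulVec (q k) = β k • ⇑(q k)) (u w : Fin m → ℝ) (τ : ℝ) :
    ∑ i, u i * (NormedSpace.exp (-(τ • B))).mulVec w i
      = ∑ k, Real.exp (-(β k * τ)) * (∑ i, q k i * u i) * (∑ i, q k i * w i) := by
  have hleft : ∀ k j, ∑ i, q k i * B i j = β k * q k j := fun k j => left_eig_of_isSymm hB (hq k) j
  calc ∑ i, u i * (NormedSpace.exp (-(τ • B))).mulVec w i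
      = ∑ i, (∑ k, (∑ j, q k j * u j) * q k i) * (NormedSpace.exp (-(τ • B))).mulVec w i := by
        refine Finset.sum_congr rfl fun i _ => ?_
        rw [← eq_sum_inner_mul_basis q u i]
    _ = ∑ k, (∑ j, q k j * u j) * ∑ i, q k i * (NormedSpace.exp (-(τ • B))).mulVec w i := by
        simp only [Finset.sum_mul, Finset.mul_sum, mul_assoc]
        rw [Finset.sum_comm]
    _ = _ := by
        refine Finset.sum_congr rfl fun k _ => ?_
        rw [sum_mul_exp_neg_smul_mulVec_of_left_eig B (hleft k) w τ]
        ring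

/-- Parseval in coordinates: `u·w = Σ_k (q_k·u)(q_k·w)` (the case `τ = 0`). [folklore] -/
theorem sum_mul_eq_sum_eig (q : OrthonormalBasis (Fin m) ℝ (EuclideanSpace ℝ (Fin m))) (u w : Fin m → ℝ) :
    ∑ i, u i * w i = ∑ k, (∑ i, q k i * u i) * (∑ i, q k i * w i) := by
  have h := sum_mul_exp_neg_smul_mulVec_eq_sum_eig (B := (1 : Matrix (Fin m) (Fin m) ℝ)) Matrix.isSymm_one q
    (fun _ => 1) (fun k => by rw [Matrix.one_mulVec, one_smul]) u w 0
  simpa only [zero_smul, neg_zero, NormedSpace.exp_zero, Matrix.one_mulVec, mul_zero, Real.exp_zero, one_mul] using h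

end Semigroup

/-! ## §2 The spectral representation of the quasi-static slot response `f_T(B)` -/

section Response

/-- Finite sums with continuous terms commute with the interval integral against a continuous weight. [folklore] -/
private theorem integral_mul_sum {ι : Type*} (t : Finset ι) {α : ℝ → ℝ} {g : ι → ℝ → ℝ} (hα : Continuous α)
    (hg : ∀ k ∈ t, Continuous (g k)) (x y : ℝ) :
    ∫ s in x..y, α s * ∑ k ∈ t, g k s = ∑ k ∈ t, ∫ s in x..y, α s * g k s := by
  rw [← intervalIntegral.integral_finsetSum]
  · refine intervalIntegral.integral_congr fun s _ => ?_
    simp only [Finset.mul_sum]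
  · exact fun k hk => (hα.mul (hg k hk)).intervalIntegrable _ _

/-- The inner Duhamel integral `s ↦ ∫₀ˢ a(x) e^{−T(s−x)β} dx` of the scalar response is continuous. [folklore] -/
theorem continuous_inner_duhamel (ρ T β : ℝ) :
    Continuous fun s : ℝ => ∫ x in (0:ℝ)..s, LatticeShear.LatticeWord.trapezoid 0 1 ρ x * Real.exp (-(T * (s - x)) * β) := by
  have hf : Continuous (Function.uncurry fun s x : ℝ => LatticeShear.LatticeWord.trapezoid 0 1 ρ x *
      Real.exp (-(T * (s - x)) * β)) :=
    ((continuous_trapezoid_unit ρ).comp continuous_snd).mul (by fun_prop)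
  exact intervalIntegral.continuous_parametric_intervalIntegral_of_continuous (a₀ := 0) hf continuous_id

/-- **Spectral representation of the quasi-static response.**  For a real symmetric `3 × 3` block `B` with an orthonormal eigenbasis
`(q_k, β_k)`: `uᵀ f_T(B) w = Σ_k f_T(β_k) (q_k·u)(q_k·w)`, `f_T = qsRespScalar ρ T` (the functional calculus of `qsResp` is EXACT on
symmetric blocks). [folklore] -/
theorem sum_sum_mul_qsResp_mul_eq_sum_eig {B : Matrix (Fin 3) (Fin 3) ℝ} (hB : B.IsSymm)
    (q : OrthonormalBasis (Fin 3) ℝ (EuclideanSpace ℝ (Fin 3))) (β : Fin 3 → ℝ)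
    (hq : ∀ k, B.mulVec (q k) = β k • ⇑(q k)) (ρ T : ℝ) (u w : Fin 3 → ℝ) :
    ∑ i, ∑ j, u i * qsResp ρ T B i j * w j
      = ∑ k, qsRespScalar ρ T (β k) * ((∑ i, q k i * u i) * (∑ i, q k i * w i)) := by
  rw [sum_sum_mul_qsResp_mul]
  set α : ℝ → ℝ := fun s => LatticeShear.LatticeWord.trapezoid 0 1 ρ s with hα
  set c : Fin 3 → ℝ := fun k => (∑ i, q k i * u i) * (∑ i, q k i * w i) with hc
  have hαc : Continuous α := continuous_trapezoid_unit ρ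
  -- the kernel on the eigenbasis
  have hker : ∀ s x : ℝ, ∑ i, ∑ j, u i * (NormedSpace.exp (-(T * (s - x)) • B)) i j * w j
      = ∑ k, Real.exp (-(T * (s - x)) * β k) * c k := by
    intro s x
    rw [neg_smul, ← sum_mul_mulVec_eq_sum_sum, sum_mul_exp_neg_smul_mulVec_eq_sum_eig hB q β hq u w]
    refine Finset.sum_congr rfl fun k _ => ?_
    have e1 : Real.exp (-(β k * (T * (s - x)))) = Real.exp (-(T * (s - x)) * β k) := by
      congr 1; ring
    rw [e1]
    simp only [hc]
    ring
  -- the inner integral, summand by summand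
  have hinner : ∀ s, ∫ x in (0:ℝ)..s, α x * ∑ i, ∑ j, u i * (NormedSpace.exp (-(T * (s - x)) • B)) i j * w j
      = ∑ k, c k * ∫ x in (0:ℝ)..s, α x * Real.exp (-(T * (s - x)) * β k) := by
    intro s
    simp only [hker]
    rw [integral_mul_sum Finset.univ (g := fun k x => Real.exp (-(T * (s - x)) * β k) * c k) hαc
      (fun k _ => by fun_prop) 0 s]
    refine Finset.sum_congr rfl fun k _ => ?_
    rw [← intervalIntegral.integral_const_mul]
    refine intervalIntegral.integral_congr fun x _ => ?_
    ring
  have houter : ∫ s in (0:ℝ)..1, α s * ∫ x in (0:ℝ)..s, α x * ∑ i, ∑ j, u i * (NormedSpace.exp (-(T * (s - x)) • B)) i j * w j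
      = ∑ k, c k * ∫ s in (0:ℝ)..1, α s * ∫ x in (0:ℝ)..s, α x * Real.exp (-(T * (s - x)) * β k) := by
    simp only [hinner]
    rw [integral_mul_sum Finset.univ
      (g := fun k s => c k * ∫ x in (0:ℝ)..s, α x * Real.exp (-(T * (s - x)) * β k)) hαc
      (fun k _ => continuous_const.mul (continuous_inner_duhamel ρ T (β k))) 0 1]
    refine Finset.sum_congr rfl fun k _ => ?_
    rw [← intervalIntegral.integral_const_mul]
    refine intervalIntegral.integral_congr fun s _ => ?_
    ring
  rw [houter, Finset.mul_sum]
  refine Finset.sum_congr rfl fun k _ => ?_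
  unfold qsRespScalar
  ring

/-- The diagonal case: `vᵀ f_T(B) v = Σ_k f_T(β_k) (q_k·v)²`. [folklore] -/
theorem sum_sum_mul_qsResp_mul_self_eq_sum_eig {B : Matrix (Fin 3) (Fin 3) ℝ} (hB : B.IsSymm)
    (q : OrthonormalBasis (Fin 3) ℝ (EuclideanSpace ℝ (Fin 3))) (β : Fin 3 → ℝ)
    (hq : ∀ k, B.mulVec (q k) = β k • ⇑(q k)) (ρ T : ℝ) (v : Fin 3 → ℝ) :
    ∑ i, ∑ j, v i * qsResp ρ T B i j * v j = ∑ k, qsRespScalar ρ T (β k) * (∑ i, q k i * v i) ^ 2 := by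
  rw [sum_sum_mul_qsResp_mul_eq_sum_eig hB q β hq]
  refine Finset.sum_congr rfl fun k _ => ?_
  rw [sq]

end Response

/-! ## §3 The inversion bulk in Loewner form: exact order-reversal above, the Majda–Kramer lag below -/

section Loewner

variable {m : ℕ}

/-- The quadratic form of a symmetric matrix on an orthonormal eigenbasis: `wᵀBw = Σ_k β_k (q_k·w)²`. [folklore] -/
theorem sum_sum_mul_mul_eq_sum_eig {B : Matrix (Fin m) (Fin m) ℝ} (hB : B.IsSymm)
    (q : OrthonormalBasis (Fin m) ℝ (EuclideanSpace ℝ (Fin m))) (β : Fin m → ℝ)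
    (hq : ∀ k, B.mulVec (q k) = β k • ⇑(q k)) (u w : Fin m → ℝ) :
    ∑ i, ∑ j, u i * B i j * w j = ∑ k, β k * ((∑ i, q k i * u i) * (∑ i, q k i * w i)) := by
  have hleft : ∀ k j, ∑ i, q k i * B i j = β k * q k j := fun k j => left_eig_of_isSymm hB (hq k) j
  calc ∑ i, ∑ j, u i * B i j * w j
      = ∑ i, u i * B.mulVec w i := (sum_mul_mulVec_eq_sum_sum B u w).symm
    _ = ∑ i, (∑ k, (∑ j, q k j * u j) * q k i) * B.mulVec w i := by
        refine Finset.sum_congr rfl fun i _ => ?_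
        rw [← eq_sum_inner_mul_basis q u i]
    _ = ∑ k, (∑ j, q k j * u j) * ∑ i, q k i * B.mulVec w i := by
        simp only [Finset.sum_mul, Finset.mul_sum, mul_assoc]
        rw [Finset.sum_comm]
    _ = _ := by
        refine Finset.sum_congr rfl fun k _ => ?_
        rw [sum_mul_mulVec_of_left_eig (hleft k) w]
        ring

/-- An eigenvalue is the Rayleigh quotient of its unit eigenvector: `β_k = q_kᵀ B q_k`; hence `a ≤ β_k` under the Loewner floor `a ≤ B`. [folklore] -/
theorem le_eig_of_loewner_floor {B : Matrix (Fin m) (Fin m) ℝ}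
    (q : OrthonormalBasis (Fin m) ℝ (EuclideanSpace ℝ (Fin m))) (β : Fin m → ℝ)
    (hq : ∀ k, B.mulVec (q k) = β k • ⇑(q k)) {a : ℝ}
    (ha : ∀ w : Fin m → ℝ, a * ∑ i, w i ^ 2 ≤ ∑ i, ∑ j, w i * B i j * w j) (k : Fin m) : a ≤ β k := by
  have hunit : ∑ i, q k i * q k i = 1 := by
    have h := q.orthonormal.1 k
    rw [@norm_eq_sqrt_real_inner, Real.sqrt_eq_one, inner_toLp_eq_sum (q k) (q k)] at h
    simpa using h
  have hquad : ∑ i, ∑ j, q k i * B i j * q k j = β k := by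
    rw [← sum_mul_mulVec_eq_sum_sum, hq k]
    simp only [Pi.smul_apply, smul_eq_mul]
    calc ∑ i, q k i * (β k * q k i) = β k * ∑ i, q k i * q k i := by
          rw [Finset.mul_sum]; exact Finset.sum_congr rfl fun i _ => by ring
      _ = β k := by rw [hunit, mul_one]
  have h := ha (q k)
  have hsq : ∑ i, (q k) i ^ 2 = 1 := by
    rw [← hunit]; exact Finset.sum_congr rfl fun i _ => by rw [sq]
  rw [hsq, mul_one, hquad] at h
  exact h

/-- **Completing the square on an eigenbasis**: for `B₀` symmetric with orthonormal eigenbasis `(q_k, β_k)`, all `β_k > 0`, and any `v, w`: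
`2 v·w − wᵀB₀w ≤ Σ_k (q_k·v)²/β_k` (the variational value of `vᵀB₀⁻¹v`). [folklore] -/
theorem two_mul_sub_quad_le_inv_form {B₀ : Matrix (Fin m) (Fin m) ℝ} (hB₀ : B₀.IsSymm)
    (q : OrthonormalBasis (Fin m) ℝ (EuclideanSpace ℝ (Fin m))) (β : Fin m → ℝ)
    (hq : ∀ k, B₀.mulVec (q k) = β k • ⇑(q k)) (hβ : ∀ k, 0 < β k) (v w : Fin m → ℝ) :
    2 * ∑ i, v i * w i - ∑ i, ∑ j, w i * B₀ i j * w j ≤ ∑ k, (∑ i, q k i * v i) ^ 2 / β k := by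
  rw [sum_mul_eq_sum_eig q v w, sum_sum_mul_mul_eq_sum_eig hB₀ q β hq w w, Finset.mul_sum, ← Finset.sum_sub_distrib]
  refine Finset.sum_le_sum fun k _ => ?_
  set x := ∑ i, q k i * v i
  set y := ∑ i, q k i * w i
  have hb := hβ k
  rw [le_div_iff₀ hb]
  nlinarith [sq_nonneg (x - β k * y)]

/-- **The inversion bulk is attained**: with `w⋆ = Σ_k ((q_k·v)/β_k) q_k` (i.e. `B⁻¹v`), `2 v·w⋆ − w⋆ᵀBw⋆ = Σ_k (q_k·v)²/β_k`
(an identity for every `β`, with Lean's `x/0 = 0` on null directions). [folklore] -/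
theorem two_mul_sub_quad_eq_inv_form {B : Matrix (Fin m) (Fin m) ℝ} (hB : B.IsSymm)
    (q : OrthonormalBasis (Fin m) ℝ (EuclideanSpace ℝ (Fin m))) (β : Fin m → ℝ)
    (hq : ∀ k, B.mulVec (q k) = β k • ⇑(q k)) (v : Fin m → ℝ) :
    2 * ∑ i, v i * (∑ k, ((∑ j, q k j * v j) / β k) * q k i)
        - ∑ i, ∑ j, (∑ k, ((∑ l, q k l * v l) / β k) * q k i) * B i j * (∑ k, ((∑ l, q k l * v l) / β k) * q k j)
      = ∑ k, (∑ i, q k i * v i) ^ 2 / β k := by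
  set w : Fin m → ℝ := fun i => ∑ k, ((∑ j, q k j * v j) / β k) * q k i with hw
  -- coordinates of `w⋆` in the eigenbasis
  have hcoord : ∀ k, ∑ i, q k i * w i = (∑ j, q k j * v j) / β k := by
    intro k
    have horth : ∀ l, ∑ i, q k i * q l i = if k = l then 1 else 0 := by
      intro l
      have h := orthonormal_iff_ite.mp q.orthonormal k l
      rw [← h, ← inner_toLp_eq_sum (q k) (q l)]
    calc ∑ i, q k i * w i = ∑ l, ((∑ j, q l j * v j) / β l) * ∑ i, q k i * q l i := by
          simp only [hw, Finset.mul_sum]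
          rw [Finset.sum_comm]
          refine Finset.sum_congr rfl fun l _ => Finset.sum_congr rfl fun i _ => by ring
      _ = _ := by
          simp only [horth, mul_ite, mul_one, mul_zero, Finset.sum_ite_eq, Finset.mem_univ, if_true]
  show 2 * ∑ i, v i * w i - ∑ i, ∑ j, w i * B i j * w j = ∑ k, (∑ i, q k i * v i) ^ 2 / β k
  rw [sum_mul_eq_sum_eig q v w, sum_sum_mul_mul_eq_sum_eig hB q β hq w w, Finset.mul_sum, ← Finset.sum_sub_distrib]
  refine Finset.sum_congr rfl fun k _ => ?_
  rw [hcoord k]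
  field_simp
  ring

/-- **UPPER FACE — the inversion bulk is exactly order-reversing.**  `B` symmetric with `B ≥ a > 0` and `B ≥ B₀` in the Loewner order;
`(q⁰_k, β⁰_k)` an orthonormal eigenbasis of the symmetric reference `B₀` with `β⁰_k > 0`; `T ≥ 0`, `0 < ρ ≤ 1/2`.  Then
`vᵀ f_T(B) v ≤ (1 − 4ρ/3) · Σ_k (q⁰_k·v)²/β⁰_k` (`= ϑ_∞ · vᵀB₀⁻¹v`): the upper law `f_T(x) ≤ ϑ_∞/x` carries no lag. [folklore] -/
theorem sum_sum_mul_qsResp_mul_le_of_loewner {B B₀ : Matrix (Fin 3) (Fin 3) ℝ} (hB : B.IsSymm) (hB₀ : B₀.IsSymm)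
    {a : ℝ} (ha0 : 0 < a) (ha : ∀ w : Fin 3 → ℝ, a * ∑ i, w i ^ 2 ≤ ∑ i, ∑ j, w i * B i j * w j)
    (hle : ∀ w : Fin 3 → ℝ, ∑ i, ∑ j, w i * B₀ i j * w j ≤ ∑ i, ∑ j, w i * B i j * w j)
    (q : OrthonormalBasis (Fin 3) ℝ (EuclideanSpace ℝ (Fin 3))) (β : Fin 3 → ℝ)
    (hq : ∀ k, B₀.mulVec (q k) = β k • ⇑(q k)) (hβ : ∀ k, 0 < β k)
    {ρ T : ℝ} (hρ : 0 < ρ) (hρ2 : ρ ≤ 1 / 2) (hT : 0 ≤ T) (v : Fin 3 → ℝ) :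
    ∑ i, ∑ j, v i * qsResp ρ T B i j * v j ≤ (1 - 4 * ρ / 3) * ∑ k, (∑ i, q k i * v i) ^ 2 / β k := by
  -- an eigenbasis of `B` itself (Mathlib's spectral theorem)
  have hH : B.IsHermitian := isHermitian_of_isSymm hB
  set e := hH.eigenvectorBasis with he
  set γ := hH.eigenvalues with hγ
  have heq : ∀ k, B.mulVec (e k) = γ k • ⇑(e k) := fun k => hH.mulVec_eigenvectorBasis k
  have hγpos : ∀ k, 0 < γ k := fun k => lt_of_lt_of_le ha0 (le_eig_of_loewner_floor e γ heq ha k)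
  -- step 1: the scalar upper law on each eigen-direction
  rw [sum_sum_mul_qsResp_mul_self_eq_sum_eig hB e γ heq]
  have h1 : ∑ k, qsRespScalar ρ T (γ k) * (∑ i, e k i * v i) ^ 2
      ≤ ∑ k, (1 - 4 * ρ / 3) / γ k * (∑ i, e k i * v i) ^ 2 :=
    Finset.sum_le_sum fun k _ => mul_le_mul_of_nonneg_right (OddGain.qsRespScalar_le hρ hρ2 hT (hγpos k)) (sq_nonneg _)
  refine h1.trans ?_
  have h2 : ∑ k, (1 - 4 * ρ / 3) / γ k * (∑ i, e k i * v i) ^ 2 = (1 - 4 * ρ / 3) * ∑ k, (∑ i, e k i * v i) ^ 2 / γ k := by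
    rw [Finset.mul_sum]
    exact Finset.sum_congr rfl fun k _ => by rw [div_mul_eq_mul_div, mul_div_assoc]
  rw [h2]
  refine mul_le_mul_of_nonneg_left ?_ (by linarith)
  -- step 2: the bulk is attained at `w⋆ = B⁻¹ v` and is order-reversing by the variational characterisation
  rw [← two_mul_sub_quad_eq_inv_form hB e γ heq v]
  set w : Fin 3 → ℝ := fun i => ∑ k, ((∑ j, e k j * v j) / γ k) * e k i
  calc 2 * ∑ i, v i * w i - ∑ i, ∑ j, w i * B i j * w j
      ≤ 2 * ∑ i, v i * w i - ∑ i, ∑ j, w i * B₀ i j * w j := by linarith [hle w]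
    _ ≤ _ := two_mul_sub_quad_le_inv_form hB₀ q β hq hβ v w

/-- **LOWER FACE — order-reversal up to the Majda–Kramer lag.**  `B` symmetric with `B ≥ a > 0` and `B ≤ B₁` in the Loewner order;
`(q¹_k, β¹_k)` an orthonormal eigenbasis of the symmetric `B₁` (necessarily `β¹_k ≥ a`); `T > 0`, `0 < ρ ≤ 1/2`.  Then
`(1 − 4ρ/3) · Σ_k (q¹_k·v)²/β¹_k − (2/(ρ T² a³)) · |v|² ≤ vᵀ f_T(B) v`: the only ORDER-REVERSAL DEFECT of `f_T` is the lag
`f_T(x) ≥ (ϑ_∞ − 2/(ρ(Tx)²))/x` of `le_qsRespScalar`, at most `2/(ρT²a³)` per unit `|v|²` on `B ≥ a`. [folklore] -/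
theorem sum_sum_mul_qsResp_mul_ge_of_loewner {B B₁ : Matrix (Fin 3) (Fin 3) ℝ} (hB : B.IsSymm) (hB₁ : B₁.IsSymm)
    {a : ℝ} (ha0 : 0 < a) (ha : ∀ w : Fin 3 → ℝ, a * ∑ i, w i ^ 2 ≤ ∑ i, ∑ j, w i * B i j * w j)
    (hle : ∀ w : Fin 3 → ℝ, ∑ i, ∑ j, w i * B i j * w j ≤ ∑ i, ∑ j, w i * B₁ i j * w j)
    (q : OrthonormalBasis (Fin 3) ℝ (EuclideanSpace ℝ (Fin 3))) (β : Fin 3 → ℝ)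
    (hq : ∀ k, B₁.mulVec (q k) = β k • ⇑(q k))
    {ρ T : ℝ} (hρ : 0 < ρ) (hρ2 : ρ ≤ 1 / 2) (hT : 0 < T) (v : Fin 3 → ℝ) :
    (1 - 4 * ρ / 3) * ∑ k, (∑ i, q k i * v i) ^ 2 / β k - 2 / (ρ * T ^ 2 * a ^ 3) * ∑ i, v i ^ 2
      ≤ ∑ i, ∑ j, v i * qsResp ρ T B i j * v j := by
  have hH : B.IsHermitian := isHermitian_of_isSymm hB
  set e := hH.eigenvectorBasis with he
  set γ := hH.eigenvalues with hγ
  have heq : ∀ k, B.mulVec (e k) = γ k • ⇑(e k) := fun k => hH.mulVec_eigenvectorBasis k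
  have hγa : ∀ k, a ≤ γ k := fun k => le_eig_of_loewner_floor e γ heq ha k
  have hγpos : ∀ k, 0 < γ k := fun k => lt_of_lt_of_le ha0 (hγa k)
  rw [sum_sum_mul_qsResp_mul_self_eq_sum_eig hB e γ heq]
  -- Parseval for `|v|²`
  have hpars : ∑ i, v i ^ 2 = ∑ k, (∑ i, e k i * v i) ^ 2 := by
    have h := sum_mul_eq_sum_eig e v v
    simpa only [sq] using h
  -- step 1: the scalar lower law per eigen-direction, lag bounded on `γ_k ≥ a`
  have hlag : ∀ k, (1 - 4 * ρ / 3) / γ k - 2 / (ρ * T ^ 2 * a ^ 3) ≤ qsRespScalar ρ T (γ k) := by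
    intro k
    have h := OddGain.le_qsRespScalar hρ hρ2 hT (hγpos k)
    refine le_trans ?_ h
    have hk := hγpos k
    have e1 : (1 - 4 * ρ / 3 - 2 / (ρ * (T * γ k) ^ 2)) / γ k = (1 - 4 * ρ / 3) / γ k - 2 / (ρ * T ^ 2 * γ k ^ 3) := by
      field_simp
    rw [e1]
    have hmono : 2 / (ρ * T ^ 2 * γ k ^ 3) ≤ 2 / (ρ * T ^ 2 * a ^ 3) := by
      apply div_le_div_of_nonneg_left (by norm_num) (by positivity)
      exact mul_le_mul_of_nonneg_left (pow_le_pow_left₀ ha0.le (hγa k) 3) (by positivity)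
    linarith
  have h1 : ∑ k, ((1 - 4 * ρ / 3) / γ k - 2 / (ρ * T ^ 2 * a ^ 3)) * (∑ i, e k i * v i) ^ 2
      ≤ ∑ k, qsRespScalar ρ T (γ k) * (∑ i, e k i * v i) ^ 2 :=
    Finset.sum_le_sum fun k _ => mul_le_mul_of_nonneg_right (hlag k) (sq_nonneg _)
  refine le_trans ?_ h1
  have h2 : ∑ k, ((1 - 4 * ρ / 3) / γ k - 2 / (ρ * T ^ 2 * a ^ 3)) * (∑ i, e k i * v i) ^ 2
      = (1 - 4 * ρ / 3) * ∑ k, (∑ i, e k i * v i) ^ 2 / γ k - 2 / (ρ * T ^ 2 * a ^ 3) * ∑ i, v i ^ 2 := by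
    rw [hpars, Finset.mul_sum, Finset.mul_sum, ← Finset.sum_sub_distrib]
    exact Finset.sum_congr rfl fun k _ => by rw [sub_mul, div_mul_eq_mul_div, mul_div_assoc]
  rw [h2]
  have hϑ : 0 ≤ 1 - 4 * ρ / 3 := by linarith
  refine sub_le_sub_right (mul_le_mul_of_nonneg_left ?_ hϑ) _
  -- step 2: the bulk `Σ (e_k·v)²/γ_k = vᵀB⁻¹v` dominates the variational value at the explicit `w = B₁⁻¹ v`
  set w : Fin 3 → ℝ := fun i => ∑ k, ((∑ j, q k j * v j) / β k) * q k i
  calc ∑ k, (∑ i, q k i * v i) ^ 2 / β k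
      = 2 * ∑ i, v i * w i - ∑ i, ∑ j, w i * B₁ i j * w j :=
        (two_mul_sub_quad_eq_inv_form hB₁ q β hq v).symm
    _ ≤ 2 * ∑ i, v i * w i - ∑ i, ∑ j, w i * B i j * w j := by linarith [hle w]
    _ ≤ _ := two_mul_sub_quad_le_inv_form hB e γ heq hγpos v w

end Loewner

end Summit.AnomalousDissipation.AnomalousDissipation.Theorems.SolenoidalFractalHomogenisation.LagrangianStep
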